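import Mathlib
import HarnessLib
import Summits.QuantumFields.YangMills.Theses.PencilRigidity
import Summits.QuantumFields.YangMills.Theorems.PencilRigidityCurvatureKernelBoundKernelOffDiagonal
import Summits.QuantumFields.YangMills.Theorems.PencilRigidityCurvatureKernelBoundOffDiagonalExtension
import Summits.QuantumFields.YangMills.Theorems.PencilRigidityCurvatureKernelBoundOffDiagonalVanishing
import Summits.QuantumFields.YangMills.Theorems.PencilRigidityCurvatureKernelBoundAxisEnvelopeSymmetry

/-!
# `CurvatureKernelBound` — stub X `KernelExistence` (support for stmt-QuantumFields-11687, line `sixteen-charts-analytic-kernel`, skeleton v11)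

Stub `KernelExistence` (X, assembly of the D-free transfer): given the half-space kernel statement (H) and the
local-representation statement (R) as hypotheses, a one-species family `S₁` on `ℝ⁴` with E2, translation invariance and
invariance under proper signed permutations on `⁰𝒮`, and polynomially controlled lattice local bounds near the time
axis has a kernel `K`, continuous on `ℝ⁴ ∖ 0`, with `S₁ 2 F = ∫ K(x₀ - x₁) F(x) dx` for every `F ∈ ⁰𝒮₂`.  Route: (H) gives
`K⁻` on `{ξ₀ < 0}` representing `S₁ 2` on tensors near every `(z₀, z₁)` with `z₀⁰ < 0 < z₁⁰`; translations and frames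
(`tensorRep_translate`, `tensorRep_frame`) represent `S₁ 2` by `K⁻ ∘ Q⁻¹` on tensors near every `w` with
`(Q⁻¹(w₀ - w₁))⁰ < 0` (`tensorRep_frame_of_halfSpace`); a frame `Φ ξ` with `((Φ ξ)⁻¹ ξ)⁰ ≤ -‖ξ‖/2`
(`exists_coord_norm_div_two_le`, `exists_signedPerm_frame`) defines `K ξ := K⁻((Φ ξ)⁻¹ ξ)`; continuous local difference
kernels are unique (`kernel_pt_eq_of_tensorRep`, by `kernel_eq_zero_on_box`), so `K = K⁻ ∘ (Φ ξ₀)⁻¹` near `ξ₀`: `K` is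
continuous off `0` and represents `S₁ 2` on tensors near every off-diagonal configuration; (R) upgrades to local
representations, `LocalKernelPatching` patches them, the bound clause of (H) at `s = min (s₁/2) (‖ξ‖/4)` gives
`‖K ξ‖ ≤ A (‖ξ‖ᵖ + ‖ξ‖⁻ᵖ)`, and `OffDiagonalExtension` extends to `⁰𝒮₂`. [folklore]
-/

noncomputable section

open scoped BigOperators Topology SchwartzMap ComplexConjugate InnerProductSpace
open MeasureTheory Filter Set Metric
open Literature.MathematicalPhysics.QuantumLattice Literature.MathematicalPhysics.AQFT
open Literature.MathematicalPhysics.QuantumFieldTheory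
open Summit.QuantumFields.YangMills.Theorems.KernelTransfer

namespace Summit.QuantumFields.YangMills.Theorems.CurvatureKernel

/-- A witnessed two-point tensor `F` of `f, g` is the tree's `tensorFin 2 ![f, g]`. [folklore] -/
theorem eq_tensorFin_of_isTensorOf_two {f g : 𝓢(EuclideanSpace ℝ (Fin 4), ℂ)} {F : 𝓢((Fin 2 → EuclideanSpace ℝ (Fin 4)), ℂ)}
    (hF : IsTensorOf F ![f, g]) :
    F = SchwartzMap.tensorFin 2 ![f, g] :=
  hF.unique (isTensorOf_tensorFin _)

/-- Tensors of test functions supported in separated balls `B(z₀, r)`, `B(z₁, r)`, `2r ≤ |z₀ - z₁|`, lie in `⁰𝒮`. [folklore] -/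
theorem isOffDiagonal_of_isTensorOf_ball {z : (Fin 2 → EuclideanSpace ℝ (Fin 4))} {r : ℝ} (hr : r + r ≤ dist (z 0) (z 1))
    {f g : 𝓢(EuclideanSpace ℝ (Fin 4), ℂ)}
    (hf : tsupport ⇑f ⊆ ball (z 0) r) (hg : tsupport ⇑g ⊆ ball (z 1) r) {F : 𝓢((Fin 2 → EuclideanSpace ℝ (Fin 4)), ℂ)}
    (hF : IsTensorOf F ![f, g]) : IsOffDiagonal F := by
  rw [eq_tensorFin_of_isTensorOf_two hF]
  exact isOffDiagonal_tensorFin_two ((ball_disjoint_ball hr).mono hf hg)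

/-- Differences of points of `B(z₀, r)`, `B(z₁, r)` lie in `B(z₀ - z₁, ρ)` once `2r ≤ ρ`. [folklore] -/
theorem sub_mem_ball_sub {z : (Fin 2 → EuclideanSpace ℝ (Fin 4))} {r ρ : ℝ} (h : r + r ≤ ρ) {x₀ x₁ : EuclideanSpace ℝ (Fin 4)}
    (h0 : x₀ ∈ ball (z 0) r) (h1 : x₁ ∈ ball (z 1) r) : x₀ - x₁ ∈ ball (z 0 - z 1) ρ := by
  rw [mem_ball, dist_eq_norm] at h0 h1 ⊢
  calc ‖x₀ - x₁ - (z 0 - z 1)‖ = ‖(x₀ - z 0) - (x₁ - z 1)‖ := by congr 1; abel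
    _ ≤ ‖x₀ - z 0‖ + ‖x₁ - z 1‖ := norm_sub_le _ _
    _ < ρ := by linarith

/-! ## Local tensor representations: transport, uniqueness, frames -/

/-- **Translating a local tensor representation.** If `T` is translation invariant on `⁰𝒮` and is integration
against `K(x₀ - x₁)` on the tensors `f ⊗ g` supported in the separated balls about `(z₀, z₁)`, then the same holds
about `(z₀ + a, z₁ + a)` (translate the factors, change variables `x ↦ x + (a, a)`). [folklore] -/
theorem tensorRep_translate (T : 𝓢((Fin 2 → EuclideanSpace ℝ (Fin 4)), ℂ) →L[ℂ] ℂ) (K : EuclideanSpace ℝ (Fin 4) → ℂ)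
    (hT : ∀ (a : EuclideanSpace ℝ (Fin 4)) (F : 𝓢((Fin 2 → EuclideanSpace ℝ (Fin 4)), ℂ)),
      IsOffDiagonal F → T (translateMulti a F) = T F)
    (z : (Fin 2 → EuclideanSpace ℝ (Fin 4))) {r : ℝ} (hr : r + r ≤ dist (z 0) (z 1))
    (hrep : ∀ f g : 𝓢(EuclideanSpace ℝ (Fin 4), ℂ), tsupport ⇑f ⊆ ball (z 0) r → tsupport ⇑g ⊆ ball (z 1) r →
      ∀ F : 𝓢((Fin 2 → EuclideanSpace ℝ (Fin 4)), ℂ), IsTensorOf F ![f, g] →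
        Integrable (fun x => K (x 0 - x 1) * F x) ∧ T F = ∫ x, K (x 0 - x 1) * F x) (a : EuclideanSpace ℝ (Fin 4)) :
    ∀ f g : 𝓢(EuclideanSpace ℝ (Fin 4), ℂ), tsupport ⇑f ⊆ ball (z 0 + a) r → tsupport ⇑g ⊆ ball (z 1 + a) r →
      ∀ F : 𝓢((Fin 2 → EuclideanSpace ℝ (Fin 4)), ℂ), IsTensorOf F ![f, g] →
        Integrable (fun x => K (x 0 - x 1) * F x) ∧ T F = ∫ x, K (x 0 - x 1) * F x := by
  intro f g hf hg F hF
  -- the factors translated back to the balls about `z 0`, `z 1`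
  have hsupp : ∀ (φ : 𝓢(EuclideanSpace ℝ (Fin 4), ℂ)) (c : EuclideanSpace ℝ (Fin 4)), tsupport ⇑φ ⊆ ball (c + a) r →
      tsupport ⇑(SchwartzMap.compSubConstCLM ℂ (-a) φ) ⊆ ball c r := by
    intro φ c hφ x hx
    have hfun : ⇑(SchwartzMap.compSubConstCLM ℂ (-a) φ) = ⇑φ ∘ fun y : EuclideanSpace ℝ (Fin 4) => y + a := by
      funext y; simp [SchwartzMap.compSubConstCLM_apply]
    rw [hfun] at hx
    have h : x + a ∈ ball (c + a) r :=
      hφ (tsupport_comp_subset_preimage (φ : EuclideanSpace ℝ (Fin 4) → ℂ) (continuous_id.add continuous_const) hx)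
    rwa [mem_ball, dist_add_right, ← mem_ball] at h
  have hF' : IsTensorOf (translateMulti (-a) F)
      ![SchwartzMap.compSubConstCLM ℂ (-a) f, SchwartzMap.compSubConstCLM ℂ (-a) g] := by
    intro x; rw [translateMulti_apply, hF]; simp [Fin.prod_univ_two, SchwartzMap.compSubConstCLM_apply]
  obtain ⟨hint, hTeq⟩ := hrep _ _ (hsupp f _ hf) (hsupp g _ hg) _ hF'
  have hoff : IsOffDiagonal F :=
    isOffDiagonal_of_isTensorOf_ball (z := fun i => z i + a) (r := r) (by simpa using hr) hf hg hF
  set ca : (Fin 2 → EuclideanSpace ℝ (Fin 4)) := fun _ => a with hca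
  have hfun : (fun x : (Fin 2 → EuclideanSpace ℝ (Fin 4)) => K (x 0 - x 1) * translateMulti (-a) F x) =
      fun x => (fun u : (Fin 2 → EuclideanSpace ℝ (Fin 4)) => K (u 0 - u 1) * F u) (x + ca) := by
    funext x
    have h5 : (fun i => x i - -a) = x + ca := by funext i; simp [ca]
    simp only [translateMulti_apply, h5, Pi.add_apply, hca, add_sub_add_right_eq_sub]
  rw [hfun] at hint hTeq
  refine ⟨by simpa only [sub_add_cancel] using hint.comp_sub_right ca, ?_⟩
  rw [← hT (-a) F hoff, hTeq, integral_add_right_eq_self (fun u : (Fin 2 → EuclideanSpace ℝ (Fin 4)) => K (u 0 - u 1) * F u) ca]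

/-- **Rotating a local tensor representation.** If `T(F ∘ R⁻¹) = T(F)` on `⁰𝒮` and `T` is integration against
`K(x₀ - x₁)` on the tensors supported in the separated balls about `(z₀, z₁)`, then `T` is integration against
`K(R(x₀ - x₁))` on the tensors supported in the balls about `(R⁻¹ z₀, R⁻¹ z₁)` (change of variables `x ↦ R x`). [folklore] -/
theorem tensorRep_frame (T : 𝓢((Fin 2 → EuclideanSpace ℝ (Fin 4)), ℂ) →L[ℂ] ℂ) (K : EuclideanSpace ℝ (Fin 4) → ℂ)
    (R : EuclideanSpace ℝ (Fin 4) ≃ₗᵢ[ℝ] EuclideanSpace ℝ (Fin 4))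
    (hT : ∀ F : 𝓢((Fin 2 → EuclideanSpace ℝ (Fin 4)), ℂ), IsOffDiagonal F → T (linActMulti R F) = T F)
    (z : (Fin 2 → EuclideanSpace ℝ (Fin 4))) {r : ℝ} (hr : r + r ≤ dist (z 0) (z 1))
    (hrep : ∀ f g : 𝓢(EuclideanSpace ℝ (Fin 4), ℂ), tsupport ⇑f ⊆ ball (z 0) r → tsupport ⇑g ⊆ ball (z 1) r →
      ∀ F : 𝓢((Fin 2 → EuclideanSpace ℝ (Fin 4)), ℂ), IsTensorOf F ![f, g] →
        Integrable (fun x => K (x 0 - x 1) * F x) ∧ T F = ∫ x, K (x 0 - x 1) * F x) :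
    ∀ f g : 𝓢(EuclideanSpace ℝ (Fin 4), ℂ), tsupport ⇑f ⊆ ball (R.symm (z 0)) r → tsupport ⇑g ⊆ ball (R.symm (z 1)) r →
      ∀ F : 𝓢((Fin 2 → EuclideanSpace ℝ (Fin 4)), ℂ), IsTensorOf F ![f, g] →
        Integrable (fun x => K (R (x 0 - x 1)) * F x) ∧ T F = ∫ x, K (R (x 0 - x 1)) * F x := by
  intro f g hf hg F hF
  -- the rotated factors `f ∘ R⁻¹`, `g ∘ R⁻¹`, supported about `z 0`, `z 1`
  have hsupp : ∀ (φ : 𝓢(EuclideanSpace ℝ (Fin 4), ℂ)) (c : EuclideanSpace ℝ (Fin 4)), tsupport ⇑φ ⊆ ball (R.symm c) r →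
      tsupport ⇑(SchwartzMap.compCLMOfContinuousLinearEquiv ℂ R.symm.toContinuousLinearEquiv φ) ⊆ ball c r := by
    intro φ c hφ x hx
    have h := hφ (apply_mem_tsupport_of_mem_tsupport_compCLMOfContinuousLinearEquiv R.symm.toContinuousLinearEquiv φ hx)
    simp only [mem_ball, LinearIsometryEquiv.coe_toContinuousLinearEquiv, LinearIsometryEquiv.dist_map] at h ⊢
    exact h
  have hF' : IsTensorOf (linActMulti R F) ![SchwartzMap.compCLMOfContinuousLinearEquiv ℂ R.symm.toContinuousLinearEquiv f,
      SchwartzMap.compCLMOfContinuousLinearEquiv ℂ R.symm.toContinuousLinearEquiv g] := by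
    intro x; rw [linActMulti_apply, hF]; simp [Fin.prod_univ_two]
  obtain ⟨hint, hTeq⟩ := hrep _ _ (hsupp f _ hf) (hsupp g _ hg) _ hF'
  have hoff : IsOffDiagonal F := isOffDiagonal_of_isTensorOf_ball (z := fun i => R.symm (z i)) (r := r)
    (by simpa only [LinearIsometryEquiv.dist_map] using hr) hf hg hF
  have hfun : (fun x : (Fin 2 → EuclideanSpace ℝ (Fin 4)) => K (R (x 0 - x 1)) * F x) =
      fun x => (fun y : (Fin 2 → EuclideanSpace ℝ (Fin 4)) => K (y 0 - y 1) * linActMulti R F y) (fun i => R (x i)) := by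
    funext x
    simp only [linActMulti_apply, LinearIsometryEquiv.symm_apply_apply, map_sub]
  refine ⟨by rw [hfun]; exact integrable_comp_isometry_two R hint, ?_⟩
  rw [← hT F hoff, hTeq, hfun]
  exact (integral_comp_isometry_two R (fun y : (Fin 2 → EuclideanSpace ℝ (Fin 4)) => K (y 0 - y 1) * linActMulti R F y)).symm

/-- **Two continuous local difference kernels of the same functional agree.** If `k₁`, `k₂` are continuous on a
ball about `z₀ - z₁` and both `k₁(x₀ - x₁)`, `k₂(x₀ - x₁)` represent `T` on the tensors supported in small balls about
`(z₀, z₁)`, then `k₁(z₀ - z₁) = k₂(z₀ - z₁)`: the difference of the two-variable kernels integrates to zero against all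
real bump tensors in a small box, so it vanishes there (`kernel_eq_zero_on_box`). [folklore] -/
theorem kernel_pt_eq_of_tensorRep (T : 𝓢((Fin 2 → EuclideanSpace ℝ (Fin 4)), ℂ) →L[ℂ] ℂ) {k₁ k₂ : EuclideanSpace ℝ (Fin 4) → ℂ}
    (z : (Fin 2 → EuclideanSpace ℝ (Fin 4))) {ρ : ℝ} (hρ : 0 < ρ)
    (h₁ : ContinuousOn k₁ (ball (z 0 - z 1) ρ)) (h₂ : ContinuousOn k₂ (ball (z 0 - z 1) ρ)) {r₁ : ℝ} (hr₁ : 0 < r₁)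
    (hrep₁ : ∀ f g : 𝓢(EuclideanSpace ℝ (Fin 4), ℂ), tsupport ⇑f ⊆ ball (z 0) r₁ → tsupport ⇑g ⊆ ball (z 1) r₁ →
      ∀ F : 𝓢((Fin 2 → EuclideanSpace ℝ (Fin 4)), ℂ), IsTensorOf F ![f, g] →
        Integrable (fun x => k₁ (x 0 - x 1) * F x) ∧ T F = ∫ x, k₁ (x 0 - x 1) * F x)
    {r₂ : ℝ} (hr₂ : 0 < r₂)
    (hrep₂ : ∀ f g : 𝓢(EuclideanSpace ℝ (Fin 4), ℂ), tsupport ⇑f ⊆ ball (z 0) r₂ → tsupport ⇑g ⊆ ball (z 1) r₂ →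
      ∀ F : 𝓢((Fin 2 → EuclideanSpace ℝ (Fin 4)), ℂ), IsTensorOf F ![f, g] →
        Integrable (fun x => k₂ (x 0 - x 1) * F x) ∧ T F = ∫ x, k₂ (x 0 - x 1) * F x) :
    k₁ (z 0 - z 1) = k₂ (z 0 - z 1) := by
  set r : ℝ := min (min r₁ r₂) (ρ / 2) with hrdef
  have hr : 0 < r := lt_min (lt_min hr₁ hr₂) (half_pos hρ)
  have hrr₁ : r ≤ r₁ := (min_le_left _ _).trans (min_le_left _ _)
  have hrr₂ : r ≤ r₂ := (min_le_left _ _).trans (min_le_right _ _)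
  have hrρ : r + r ≤ ρ := by linarith [min_le_right (min r₁ r₂) (ρ / 2)]
  have hd : Continuous fun x : (Fin 2 → EuclideanSpace ℝ (Fin 4)) => x 0 - x 1 := (continuous_apply 0).sub (continuous_apply 1)
  have hk : ContinuousOn (fun x : (Fin 2 → EuclideanSpace ℝ (Fin 4)) => k₁ (x 0 - x 1) - k₂ (x 0 - x 1))
      {x | x 0 ∈ ball (z 0) r ∧ x 1 ∈ ball (z 1) r} :=
    (h₁.comp hd.continuousOn fun x hx => sub_mem_ball_sub hrρ hx.1 hx.2).sub
      (h₂.comp hd.continuousOn fun x hx => sub_mem_ball_sub hrρ hx.1 hx.2)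
  refine sub_eq_zero.1 (kernel_eq_zero_on_box hk (fun φ ψ hφ hψ => ?_) z (mem_ball_self hr) (mem_ball_self hr))
  have htφ : tsupport (ofRealTest φ : EuclideanSpace ℝ (Fin 4) → ℂ) ⊆ ball (z 0) r :=
    (tsupport_comp_subset (g := fun t : ℝ => (t : ℂ)) Complex.ofReal_zero _).trans hφ
  have htψ : tsupport (ofRealTest ψ : EuclideanSpace ℝ (Fin 4) → ℂ) ⊆ ball (z 1) r :=
    (tsupport_comp_subset (g := fun t : ℝ => (t : ℂ)) Complex.ofReal_zero _).trans hψ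
  obtain ⟨i₁, e₁⟩ := hrep₁ _ _ (htφ.trans (ball_subset_ball hrr₁)) (htψ.trans (ball_subset_ball hrr₁)) _ (isTensorOf_tensorFin _)
  obtain ⟨i₂, e₂⟩ := hrep₂ _ _ (htφ.trans (ball_subset_ball hrr₂)) (htψ.trans (ball_subset_ball hrr₂)) _ (isTensorOf_tensorFin _)
  simp_rw [sub_mul]
  exact ⟨i₁.sub i₂, by rw [integral_sub i₁ i₂, ← e₁, ← e₂, sub_self]⟩

/-- **Local tensor representations in a frame.** Let `S₁ 2` be translation invariant on `⁰𝒮` and represented by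
`K⁻(x₀ - x₁)` on the tensors supported near every configuration `(z₀, z₁)` with `z₀⁰ < 0 < z₁⁰`, and let `Q` be a
linear isometry with `S₁ 2 (F ∘ Q⁻¹) = S₁ 2 F` on `⁰𝒮`. Then near every `w` with `(Q⁻¹(w₀ - w₁))⁰ < 0` the functional
`S₁ 2` is represented on tensors by `K⁻(Q⁻¹(x₀ - x₁))`: rotate `w` by `Q⁻¹`, recentre in time by a translation, and
transport back (`tensorRep_translate`, `tensorRep_frame`). [folklore] -/
theorem tensorRep_frame_of_halfSpace (S₁ : SchwingerFamily (EuclideanSpace ℝ (Fin 4)))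
    (hT : ∀ (a : EuclideanSpace ℝ (Fin 4)) (F : 𝓢((Fin 2 → EuclideanSpace ℝ (Fin 4)), ℂ)),
      IsOffDiagonal F → S₁ 2 (translateMulti a F) = S₁ 2 F) (Km : EuclideanSpace ℝ (Fin 4) → ℂ)
    (hKm : ∀ z : (Fin 2 → EuclideanSpace ℝ (Fin 4)), z 0 0 < 0 → 0 < z 1 0 → ∃ r : ℝ, 0 < r ∧
      ∀ f g : 𝓢(EuclideanSpace ℝ (Fin 4), ℂ), tsupport ⇑f ⊆ ball (z 0) r → tsupport ⇑g ⊆ ball (z 1) r →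
        ∀ F : 𝓢((Fin 2 → EuclideanSpace ℝ (Fin 4)), ℂ), IsTensorOf F ![f, g] →
          Integrable (fun x => Km (x 0 - x 1) * F x) ∧ S₁ 2 F = ∫ x, Km (x 0 - x 1) * F x)
    (Q : EuclideanSpace ℝ (Fin 4) ≃ₗᵢ[ℝ] EuclideanSpace ℝ (Fin 4))
    (hQ : ∀ F : 𝓢((Fin 2 → EuclideanSpace ℝ (Fin 4)), ℂ), IsOffDiagonal F → S₁ 2 (linActMulti Q F) = S₁ 2 F)
    (w : (Fin 2 → EuclideanSpace ℝ (Fin 4))) (hw : (Q.symm (w 0 - w 1)) 0 < 0) :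
    ∃ r : ℝ, 0 < r ∧ ∀ f g : 𝓢(EuclideanSpace ℝ (Fin 4), ℂ), tsupport ⇑f ⊆ ball (w 0) r → tsupport ⇑g ⊆ ball (w 1) r →
      ∀ F : 𝓢((Fin 2 → EuclideanSpace ℝ (Fin 4)), ℂ), IsTensorOf F ![f, g] →
        Integrable (fun x => Km (Q.symm (x 0 - x 1)) * F x) ∧ S₁ 2 F = ∫ x, Km (Q.symm (x 0 - x 1)) * F x := by
  -- the rotated configuration `z = Q⁻¹ w` and its time-recentred translate `z' = z - a`
  obtain ⟨z, hz⟩ : ∃ z : (Fin 2 → EuclideanSpace ℝ (Fin 4)), ∀ i, z i = Q.symm (w i) := ⟨_, fun _ => rfl⟩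
  have hz01 : z 0 0 < z 1 0 := by
    have h : (z 0 - z 1) 0 < 0 := by rw [hz 0, hz 1, ← map_sub]; exact hw
    rw [PiLp.sub_apply] at h; linarith
  set c : ℝ := (z 0 0 + z 1 0) / 2 with hc
  set a : EuclideanSpace ℝ (Fin 4) := EuclideanSpace.single (0 : Fin 4) c with ha
  obtain ⟨z', hz'⟩ : ∃ z' : (Fin 2 → EuclideanSpace ℝ (Fin 4)), ∀ i, z' i = z i - a := ⟨_, fun _ => rfl⟩
  have hz'0 : z' 0 0 < 0 := by rw [hz' 0, PiLp.sub_apply, ha, PiLp.single_apply, if_pos rfl, hc]; linarith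
  have hz'1 : 0 < z' 1 0 := by rw [hz' 1, PiLp.sub_apply, ha, PiLp.single_apply, if_pos rfl, hc]; linarith
  obtain ⟨r, hr, hrep⟩ := hKm z' hz'0 hz'1
  -- separation
  have hd : 0 < dist (w 0) (w 1) :=
    dist_pos.2 fun h => lt_irrefl (0 : ℝ) (by rw [h, sub_self, map_zero, PiLp.zero_apply] at hw; exact hw)
  have hdz : dist (z 0) (z 1) = dist (w 0) (w 1) := by rw [hz 0, hz 1, LinearIsometryEquiv.dist_map]
  have hdz' : dist (z' 0) (z' 1) = dist (w 0) (w 1) := by rw [hz' 0, hz' 1, dist_sub_right, hdz]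
  set r' : ℝ := min r (dist (w 0) (w 1) / 2) with hr'def
  have hr' : 0 < r' := lt_min hr (half_pos hd)
  have hr'r : r' ≤ r := min_le_left _ _
  have hr'd : r' + r' ≤ dist (w 0) (w 1) := by linarith [min_le_right r (dist (w 0) (w 1) / 2)]
  have hrep' : ∀ f g : 𝓢(EuclideanSpace ℝ (Fin 4), ℂ), tsupport ⇑f ⊆ ball (z' 0) r' → tsupport ⇑g ⊆ ball (z' 1) r' →
      ∀ F : 𝓢((Fin 2 → EuclideanSpace ℝ (Fin 4)), ℂ), IsTensorOf F ![f, g] →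
        Integrable (fun x => Km (x 0 - x 1) * F x) ∧ S₁ 2 F = ∫ x, Km (x 0 - x 1) * F x :=
    fun f g hf hg F hF => hrep f g (hf.trans (ball_subset_ball hr'r)) (hg.trans (ball_subset_ball hr'r)) F hF
  -- translate back to `z`
  have hrepz := tensorRep_translate (S₁ 2) Km hT z' (by rw [hdz']; exact hr'd) hrep' a
  have hza : ∀ i, z' i + a = z i := fun i => by rw [hz' i, sub_add_cancel]
  simp only [hza] at hrepz
  -- rotate back to `w` by `Q⁻¹` (a symmetry of `S₁ 2` on `⁰𝒮` as well)
  have hQ' : ∀ F : 𝓢((Fin 2 → EuclideanSpace ℝ (Fin 4)), ℂ), IsOffDiagonal F → S₁ 2 (linActMulti Q.symm F) = S₁ 2 F := by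
    intro F hF
    have h1 : linActMulti Q (linActMulti Q.symm F) = F := by ext x; simp
    rw [← hQ _ (isOffDiagonal_linActMulti Q.symm hF), h1]
  have h := tensorRep_frame (S₁ 2) Km Q.symm hQ' z (by rw [hdz]; exact hr'd) hrepz
  refine ⟨r', hr', fun f g hf hg F hF => h f g ?_ ?_ F hF⟩
  · rw [LinearIsometryEquiv.symm_symm, hz 0, LinearIsometryEquiv.apply_symm_apply]; exact hf
  · rw [LinearIsometryEquiv.symm_symm, hz 1, LinearIsometryEquiv.apply_symm_apply]; exact hg

/-! ## The stub -/

/-- **Stub `KernelExistence`** (registered signature verbatim). See the module docstring. [folklore] -/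
theorem KernelExistence : open Literature.MathematicalPhysics.QuantumLattice Literature.MathematicalPhysics.AQFT Literature.MathematicalPhysics.QuantumFieldTheory in (∀ (S₁ : SchwingerFamily (EuclideanSpace ℝ (Fin 4))), S₁.toLabelled.IsReflectionPositive → (∀ (n : ℕ) (a : (EuclideanSpace ℝ (Fin 4))) (F : SchwartzMap (Fin n → (EuclideanSpace ℝ (Fin 4))) ℂ), IsOffDiagonal F → S₁ n (translateMulti a F) = S₁ n F) → ∀ (s₁ : ℝ), 0 < s₁ → (∀ (s : ℝ), 0 < s → s < s₁ → ∃ (r₀ A B : ℝ), 0 < r₀ ∧ 0 ≤ A ∧ 0 ≤ B ∧ (∀ (r : ℝ), 0 < r → r ≤ r₀ → ∀ (f : Fin 2 → SchwartzMap (EuclideanSpace ℝ (Fin 4)) ℝ) (F : SchwartzMap (Fin 2 → (EuclideanSpace ℝ (Fin 4))) ℂ) (M₀ M₁ : ℝ), IsTensorOf F (fun i => ofRealTest (f i)) → tsupport ((f 0 : SchwartzMap (EuclideanSpace ℝ (Fin 4)) ℝ) : (EuclideanSpace ℝ (Fin 4)) → ℝ) ⊆ Metric.closedBall (EuclideanSpace.single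 (0 : Fin 4) (-s)) r → tsupport ((f 1 : SchwartzMap (EuclideanSpace ℝ (Fin 4)) ℝ) : (EuclideanSpace ℝ (Fin 4)) → ℝ) ⊆ Metric.closedBall (EuclideanSpace.single (0 : Fin 4) s) r → (∀ x, |f 0 x| ≤ M₀) → (∀ x, |f 1 x| ≤ M₁) → ‖S₁ 2 F‖ ≤ A * (∫ x : (EuclideanSpace ℝ (Fin 4)), |f 0 x|) * (∫ x : (EuclideanSpace ℝ (Fin 4)), |f 1 x|) + B * r ^ 8 * M₀ * M₁)) → ∃ (K : (EuclideanSpace ℝ (Fin 4)) → ℂ) (c₀ : ℝ), 0 ≤ c₀ ∧ ContinuousOn K {ξ : (EuclideanSpace ℝ (Fin 4)) | ξ 0 < 0} ∧ (∀ (s r₀ A B : ℝ), 0 < s → s < s₁ → 0 < r₀ → 0 ≤ A → 0 ≤ B → (∀ (r : ℝ), 0 < r → r ≤ r₀ → ∀ (f : Fin 2 → SchwartzMap (EuclideanSpace ℝ (Fin 4)) ℝ) (F : SchwartzMap (Fin 2 → (EuclideanSpace ℝ (Fin 4))) ℂ) (M₀ M₁ : ℝ), IsTensorOf F (fun i =>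 ofRealTest (f i)) → tsupport ((f 0 : SchwartzMap (EuclideanSpace ℝ (Fin 4)) ℝ) : (EuclideanSpace ℝ (Fin 4)) → ℝ) ⊆ Metric.closedBall (EuclideanSpace.single (0 : Fin 4) (-s)) r → tsupport ((f 1 : SchwartzMap (EuclideanSpace ℝ (Fin 4)) ℝ) : (EuclideanSpace ℝ (Fin 4)) → ℝ) ⊆ Metric.closedBall (EuclideanSpace.single (0 : Fin 4) s) r → (∀ x, |f 0 x| ≤ M₀) → (∀ x, |f 1 x| ≤ M₁) → ‖S₁ 2 F‖ ≤ A * (∫ x : (EuclideanSpace ℝ (Fin 4)), |f 0 x|) * (∫ x : (EuclideanSpace ℝ (Fin 4)), |f 1 x|) + B * r ^ 8 * M₀ * M₁) → ∀ ξ : (EuclideanSpace ℝ (Fin 4)), ξ 0 ≤ -(2 * s) → ‖K ξ‖ ≤ A + c₀ * B) ∧ (∀ z : Fin 2 → (EuclideanSpace ℝ (Fin 4)), z 0 0 < 0 → 0 < z 1 0 → ∃ r : ℝ, 0 < r ∧ ∀ (f g : SchwartzMap (EuclideanSpace ℝ (Fin 4)) ℂ), tsupport (f : (EuclideanSpace ℝ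 (Fin 4)) → ℂ) ⊆ Metric.ball (z 0) r → tsupport (g : (EuclideanSpace ℝ (Fin 4)) → ℂ) ⊆ Metric.ball (z 1) r → ∀ F : SchwartzMap (Fin 2 → (EuclideanSpace ℝ (Fin 4))) ℂ, IsTensorOf F ![f, g] → MeasureTheory.Integrable (fun x : Fin 2 → (EuclideanSpace ℝ (Fin 4)) => K (x 0 - x 1) * F x) ∧ S₁ 2 F = ∫ x : Fin 2 → (EuclideanSpace ℝ (Fin 4)), K (x 0 - x 1) * F x)) → (∀ (T : SchwartzMap (Fin 2 → (EuclideanSpace ℝ (Fin 4))) ℂ →L[ℂ] ℂ) (K : (EuclideanSpace ℝ (Fin 4)) → ℂ) (W : Set (EuclideanSpace ℝ (Fin 4))), IsOpen W → ContinuousOn K W → ∀ (z : Fin 2 → (EuclideanSpace ℝ (Fin 4))) (r : ℝ), 0 < r → (∀ x y : (EuclideanSpace ℝ (Fin 4)), x ∈ Metric.ball (z 0) r → y ∈ Metric.ball (z 1) r → x - y ∈ W) → (∀ (f g : SchwartzMap (EuclideanSpace ℝ (Fin 4)) ℂ), tsupport (f : (EuclideanSpace ℝ (Fin 4)) → ℂ)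 ⊆ Metric.ball (z 0) r → tsupport (g : (EuclideanSpace ℝ (Fin 4)) → ℂ) ⊆ Metric.ball (z 1) r → ∀ F : SchwartzMap (Fin 2 → (EuclideanSpace ℝ (Fin 4))) ℂ, IsTensorOf F ![f, g] → MeasureTheory.Integrable (fun x : Fin 2 → (EuclideanSpace ℝ (Fin 4)) => K (x 0 - x 1) * F x) ∧ T F = ∫ x : Fin 2 → (EuclideanSpace ℝ (Fin 4)), K (x 0 - x 1) * F x) → ∃ O : Set (Fin 2 → (EuclideanSpace ℝ (Fin 4))), IsOpen O ∧ z ∈ O ∧ ∀ F : SchwartzMap (Fin 2 → (EuclideanSpace ℝ (Fin 4))) ℂ, tsupport (F : (Fin 2 → (EuclideanSpace ℝ (Fin 4))) → ℂ) ⊆ O → MeasureTheory.Integrable (fun x : Fin 2 → (EuclideanSpace ℝ (Fin 4)) => K (x 0 - x 1) * F x) ∧ T F = ∫ x : Fin 2 → (EuclideanSpace ℝ (Fin 4)), K (x 0 - x 1) * F x) → ∀ (S₁ : SchwingerFamily (EuclideanSpace ℝ (Fin 4))), S₁.toLabelled.IsReflectionPositive → (∀ (n : ℕ) (a : (EuclideanSpace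 ℝ (Fin 4))) (F : SchwartzMap (Fin n → (EuclideanSpace ℝ (Fin 4))) ℂ), IsOffDiagonal F → S₁ n (translateMulti a F) = S₁ n F) → (∀ (R : (EuclideanSpace ℝ (Fin 4)) ≃ₗᵢ[ℝ] (EuclideanSpace ℝ (Fin 4))), LinearMap.det (R.toLinearEquiv : (EuclideanSpace ℝ (Fin 4)) →ₗ[ℝ] (EuclideanSpace ℝ (Fin 4))) = 1 → (∀ i : Fin 4, ∃ j : Fin 4, R (EuclideanSpace.single i 1) = EuclideanSpace.single j 1 ∨ R (EuclideanSpace.single i 1) = -EuclideanSpace.single j 1) → ∀ (n : ℕ) (F : SchwartzMap (Fin n → (EuclideanSpace ℝ (Fin 4))) ℂ), IsOffDiagonal F → S₁ n (linActMulti R F) = S₁ n F) → (∃ (s₁ A₀ : ℝ) (p₀ : ℕ), 0 < s₁ ∧ 0 ≤ A₀ ∧ (∀ (s : ℝ), 0 < s → s < s₁ → ∃ (r₀ A B : ℝ), 0 < r₀ ∧ 0 ≤ A ∧ 0 ≤ B ∧ A + B ≤ A₀ * (1 + s⁻¹ ^ p₀) ∧ (∀ (r : ℝ), 0 < r → r ≤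 r₀ → ∀ (f : Fin 2 → SchwartzMap (EuclideanSpace ℝ (Fin 4)) ℝ) (F : SchwartzMap (Fin 2 → (EuclideanSpace ℝ (Fin 4))) ℂ) (M₀ M₁ : ℝ), IsTensorOf F (fun i => ofRealTest (f i)) → tsupport ((f 0 : SchwartzMap (EuclideanSpace ℝ (Fin 4)) ℝ) : (EuclideanSpace ℝ (Fin 4)) → ℝ) ⊆ Metric.closedBall (EuclideanSpace.single (0 : Fin 4) (-s)) r → tsupport ((f 1 : SchwartzMap (EuclideanSpace ℝ (Fin 4)) ℝ) : (EuclideanSpace ℝ (Fin 4)) → ℝ) ⊆ Metric.closedBall (EuclideanSpace.single (0 : Fin 4) s) r → (∀ x, |f 0 x| ≤ M₀) → (∀ x, |f 1 x| ≤ M₁) → ‖S₁ 2 F‖ ≤ A * (∫ x : (EuclideanSpace ℝ (Fin 4)), |f 0 x|) * (∫ x : (EuclideanSpace ℝ (Fin 4)), |f 1 x|) + B * r ^ 8 * M₀ * M₁))) → ∃ K : (EuclideanSpace ℝ (Fin 4)) → ℂ, ContinuousOn K {x : (EuclideanSpace ℝ (Fin 4)) | x ≠ 0} ∧ ∀ F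 : SchwartzMap (Fin 2 → (EuclideanSpace ℝ (Fin 4))) ℂ, IsOffDiagonal F → MeasureTheory.Integrable (fun x : Fin 2 → (EuclideanSpace ℝ (Fin 4)) => K (x 0 - x 1) * F x) ∧ S₁ 2 F = ∫ x : Fin 2 → (EuclideanSpace ℝ (Fin 4)), K (x 0 - x 1) * F x := by
  intro hH hR S₁ hE2 hT hHyp hfam
  obtain ⟨s₁, A₀, p₀, hs₁, hA₀, hfam⟩ := hfam
  have hT2 : ∀ (a : EuclideanSpace ℝ (Fin 4)) (F : 𝓢((Fin 2 → EuclideanSpace ℝ (Fin 4)), ℂ)),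
      IsOffDiagonal F → S₁ 2 (translateMulti a F) = S₁ 2 F := fun a F hF => hT 2 a F hF
  /- Step 1: the half-space kernel `Km` of (H). -/
  obtain ⟨Km, c₀, hc₀, hKm_cont, hKm_bd, hKm_rep⟩ := hH S₁ hE2 hT s₁ hs₁ (fun s hs hs' => by
    obtain ⟨r₀, A, B, hr₀, hA, hB, -, hLB⟩ := hfam s hs hs'
    exact ⟨r₀, A, B, hr₀, hA, hB, hLB⟩)
  /- Step 2: frames. For every `ξ` a symmetry `Φ ξ` of `S₁ 2` on `⁰𝒮` with `((Φ ξ)⁻¹ ξ)₀ ≤ -‖ξ‖/2`. -/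
  have hsel : ∀ ξ : EuclideanSpace ℝ (Fin 4), ∃ Q : EuclideanSpace ℝ (Fin 4) ≃ₗᵢ[ℝ] EuclideanSpace ℝ (Fin 4),
      (∀ F : 𝓢((Fin 2 → EuclideanSpace ℝ (Fin 4)), ℂ), IsOffDiagonal F → S₁ 2 (linActMulti Q F) = S₁ 2 F) ∧
      (ξ ≠ 0 → (Q.symm ξ) 0 ≤ -(‖ξ‖ / 2)) := by
    intro ξ
    have hfr : ∀ (μ : Fin 4) (s : ℝ), s = 1 ∨ s = -1 → ∃ Q : EuclideanSpace ℝ (Fin 4) ≃ₗᵢ[ℝ] EuclideanSpace ℝ (Fin 4),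
        (∀ F : 𝓢((Fin 2 → EuclideanSpace ℝ (Fin 4)), ℂ), IsOffDiagonal F → S₁ 2 (linActMulti Q F) = S₁ 2 F) ∧
          ∀ η : EuclideanSpace ℝ (Fin 4), (Q.symm η) 0 = s * η μ := by
      intro μ s hs
      obtain ⟨ν, hν⟩ := exists_ne μ
      obtain ⟨P, hdet, hsign, h0, -⟩ := exists_signedPerm_frame μ ν hν.symm hs (Or.inl rfl)
      refine ⟨P, fun F hF => hHyp P hdet hsign 2 F hF, fun ξ => ?_⟩
      rw [← inner_single_zero_one (P.symm ξ), ← P.inner_map_map, P.apply_symm_apply, h0, real_inner_smul_right,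
        EuclideanSpace.inner_single_right]
      simp
    by_cases hξ : ξ = 0
    · obtain ⟨Q, hQ, -⟩ := hfr 0 1 (Or.inl rfl)
      exact ⟨Q, hQ, fun h => absurd hξ h⟩
    obtain ⟨μ, -, hμ⟩ := exists_coord_norm_div_two_le ξ hξ
    by_cases hsgn : 0 ≤ ξ μ
    · obtain ⟨Q, hQ, hQξ⟩ := hfr μ (-1) (Or.inr rfl)
      refine ⟨Q, hQ, fun _ => ?_⟩
      rw [abs_of_nonneg hsgn] at hμ
      rw [hQξ]
      linarith
    · obtain ⟨Q, hQ, hQξ⟩ := hfr μ 1 (Or.inl rfl)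
      refine ⟨Q, hQ, fun _ => ?_⟩
      rw [abs_of_neg (lt_of_not_ge hsgn)] at hμ
      rw [hQξ]
      linarith
  choose Φ hΦ_inv hΦ_le using hsel
  have hΦ_neg : ∀ ξ : EuclideanSpace ℝ (Fin 4), ξ ≠ 0 → ((Φ ξ).symm ξ) 0 < 0 := fun ξ hξ => by
    linarith [hΦ_le ξ hξ, norm_pos_iff.2 hξ]
  /- Step 3: local tensor representations of `Km ∘ Q⁻¹` in every good frame `Q`, and their continuity. -/
  have hrepQ : ∀ Q : EuclideanSpace ℝ (Fin 4) ≃ₗᵢ[ℝ] EuclideanSpace ℝ (Fin 4),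
      (∀ F : 𝓢((Fin 2 → EuclideanSpace ℝ (Fin 4)), ℂ), IsOffDiagonal F → S₁ 2 (linActMulti Q F) = S₁ 2 F) →
      ∀ w : (Fin 2 → EuclideanSpace ℝ (Fin 4)), (Q.symm (w 0 - w 1)) 0 < 0 → ∃ r : ℝ, 0 < r ∧
        ∀ f g : 𝓢(EuclideanSpace ℝ (Fin 4), ℂ), tsupport ⇑f ⊆ ball (w 0) r → tsupport ⇑g ⊆ ball (w 1) r →
          ∀ F : 𝓢((Fin 2 → EuclideanSpace ℝ (Fin 4)), ℂ), IsTensorOf F ![f, g] → Integrable (fun x => Km (Q.symm (x 0 - x 1)) * F x) ∧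
            S₁ 2 F = ∫ x, Km (Q.symm (x 0 - x 1)) * F x :=
    fun Q hQ w hw => tensorRep_frame_of_halfSpace S₁ hT2 Km hKm_rep Q hQ w hw
  have hVopen : ∀ Q : EuclideanSpace ℝ (Fin 4) ≃ₗᵢ[ℝ] EuclideanSpace ℝ (Fin 4), IsOpen {ξ | (Q.symm ξ) 0 < 0} := fun Q =>
    isOpen_lt ((PiLp.continuous_apply 2 _ (0 : Fin 4)).comp Q.symm.continuous) continuous_const
  have hKQcont : ∀ Q : EuclideanSpace ℝ (Fin 4) ≃ₗᵢ[ℝ] EuclideanSpace ℝ (Fin 4),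
      ContinuousOn (fun ξ => Km (Q.symm ξ)) {ξ | (Q.symm ξ) 0 < 0} := fun Q =>
    hKm_cont.comp Q.symm.continuous.continuousOn fun ξ hξ => hξ
  /- Step 4: the global kernel `K ξ = Km ((Φ ξ)⁻¹ ξ)` and the local frame identity (uniqueness of local kernels). -/
  obtain ⟨K, hK⟩ : ∃ K : EuclideanSpace ℝ (Fin 4) → ℂ, ∀ ξ, K ξ = Km ((Φ ξ).symm ξ) := ⟨_, fun _ => rfl⟩
  have hKloc : ∀ ξ₀ : EuclideanSpace ℝ (Fin 4), ξ₀ ≠ 0 → ∀ ξ : EuclideanSpace ℝ (Fin 4), ξ ≠ 0 →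
      ((Φ ξ₀).symm ξ) 0 < 0 → K ξ = Km ((Φ ξ₀).symm ξ) := by
    intro ξ₀ hξ₀ ξ hξ hV
    have hzc : (![ξ, 0] : (Fin 2 → EuclideanSpace ℝ (Fin 4))) 0 - (![ξ, 0] : (Fin 2 → EuclideanSpace ℝ (Fin 4))) 1 = ξ := by simp
    obtain ⟨r₁, hr₁, hrep₁⟩ := hrepQ (Φ ξ) (hΦ_inv ξ) ![ξ, 0] (by rw [hzc]; exact hΦ_neg ξ hξ)
    obtain ⟨r₂, hr₂, hrep₂⟩ := hrepQ (Φ ξ₀) (hΦ_inv ξ₀) ![ξ, 0] (by rw [hzc]; exact hV)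
    have hU : IsOpen ({η | ((Φ ξ).symm η) 0 < 0} ∩ {η | ((Φ ξ₀).symm η) 0 < 0}) := (hVopen _).inter (hVopen _)
    obtain ⟨ρ, hρ, hρU⟩ := Metric.isOpen_iff.1 hU ξ ⟨hΦ_neg ξ hξ, hV⟩
    have h := kernel_pt_eq_of_tensorRep (S₁ 2) (k₁ := fun η => Km ((Φ ξ).symm η)) (k₂ := fun η => Km ((Φ ξ₀).symm η))
      ![ξ, 0] hρ (by rw [hzc]; exact (hKQcont (Φ ξ)).mono (hρU.trans inter_subset_left))
      (by rw [hzc]; exact (hKQcont (Φ ξ₀)).mono (hρU.trans inter_subset_right)) hr₁ hrep₁ hr₂ hrep₂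
    rw [hzc] at h
    rw [hK]
    exact h
  /- Step 5: continuity of `K` off `0`. -/
  have hKcont : ContinuousOn K {ξ : EuclideanSpace ℝ (Fin 4) | ξ ≠ 0} := by
    intro ξ₀ hξ₀
    have hξ₀' : ξ₀ ≠ 0 := hξ₀
    have hopen : IsOpen ({ξ | ((Φ ξ₀).symm ξ) 0 < 0} ∩ {ξ : EuclideanSpace ℝ (Fin 4) | ξ ≠ 0}) := (hVopen _).inter isOpen_compl_singleton
    have hca : ContinuousAt (fun ξ => Km ((Φ ξ₀).symm ξ)) ξ₀ :=
      (hKQcont (Φ ξ₀)).continuousAt ((hVopen _).mem_nhds (hΦ_neg ξ₀ hξ₀'))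
    refine (hca.congr_of_eventuallyEq ?_).continuousWithinAt
    filter_upwards [hopen.mem_nhds ⟨hΦ_neg ξ₀ hξ₀', hξ₀'⟩] with ξ hξ
    exact hKloc ξ₀ hξ₀' ξ hξ.2 hξ.1
  /- Step 6: local tensor representations of `K` near every off-diagonal configuration. -/
  have hKrep : ∀ z : (Fin 2 → EuclideanSpace ℝ (Fin 4)), z 0 ≠ z 1 → ∃ r : ℝ, 0 < r ∧ r + r ≤ dist (z 0) (z 1) ∧
      ∀ f g : 𝓢(EuclideanSpace ℝ (Fin 4), ℂ), tsupport ⇑f ⊆ ball (z 0) r → tsupport ⇑g ⊆ ball (z 1) r →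
        ∀ F : 𝓢((Fin 2 → EuclideanSpace ℝ (Fin 4)), ℂ), IsTensorOf F ![f, g] →
          Integrable (fun x => K (x 0 - x 1) * F x) ∧ S₁ 2 F = ∫ x, K (x 0 - x 1) * F x := by
    intro z hz
    have hξ₀ : z 0 - z 1 ≠ 0 := sub_ne_zero.2 hz
    have hd : 0 < dist (z 0) (z 1) := dist_pos.2 hz
    obtain ⟨r, hr, hrep⟩ := hrepQ (Φ (z 0 - z 1)) (hΦ_inv _) z (hΦ_neg _ hξ₀)
    have hopen : IsOpen ({ξ : EuclideanSpace ℝ (Fin 4) | ((Φ (z 0 - z 1)).symm ξ) 0 < 0} ∩ {ξ : EuclideanSpace ℝ (Fin 4) | ξ ≠ 0}) :=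
      (hVopen _).inter isOpen_compl_singleton
    obtain ⟨ρ, hρ, hρU⟩ := Metric.isOpen_iff.1 hopen (z 0 - z 1) ⟨hΦ_neg _ hξ₀, hξ₀⟩
    set r' : ℝ := min (min r (ρ / 2)) (dist (z 0) (z 1) / 2) with hr'def
    have hr' : 0 < r' := lt_min (lt_min hr (half_pos hρ)) (half_pos hd)
    have hr'r : r' ≤ r := (min_le_left _ _).trans (min_le_left _ _)
    have hr'ρ : r' + r' ≤ ρ := by linarith [((min_le_left _ _).trans (min_le_right _ _) : r' ≤ ρ / 2)]
    have hr'd : r' + r' ≤ dist (z 0) (z 1) := by linarith [min_le_right (min r (ρ / 2)) (dist (z 0) (z 1) / 2)]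
    refine ⟨r', hr', hr'd, fun f g hf hg F hF => ?_⟩
    have hfun : (fun x : (Fin 2 → EuclideanSpace ℝ (Fin 4)) => K (x 0 - x 1) * F x) = fun x => Km ((Φ (z 0 - z 1)).symm (x 0 - x 1)) * F x := by
      funext x
      by_cases hx : F x = 0
      · rw [hx, mul_zero, mul_zero]
      rw [eq_tensorFin_of_isTensorOf_two hF, tensorFin_two_apply] at hx
      obtain ⟨h0, h1⟩ := mul_ne_zero_iff.1 hx
      have hmem : x 0 - x 1 ∈ ball (z 0 - z 1) ρ := sub_mem_ball_sub hr'ρ (hf (subset_tsupport _ h0)) (hg (subset_tsupport _ h1))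
      rw [hKloc (z 0 - z 1) hξ₀ (x 0 - x 1) (hρU hmem).2 (hρU hmem).1]
    rw [hfun]
    exact hrep f g (hf.trans (ball_subset_ball hr'r)) (hg.trans (ball_subset_ball hr'r)) F hF
  /- Step 7: local representations on open sets by (R), patched off the diagonal. -/
  have hΩ : IsOpen {x : (Fin 2 → EuclideanSpace ℝ (Fin 4)) | x 0 ≠ x 1} := isOpen_ne_fun (continuous_apply 0) (continuous_apply 1)
  have hκ : ContinuousOn (fun x : (Fin 2 → EuclideanSpace ℝ (Fin 4)) => K (x 0 - x 1)) {x | x 0 ≠ x 1} :=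
    hKcont.comp ((continuous_apply 0).sub (continuous_apply 1)).continuousOn fun x hx => sub_ne_zero.2 hx
  have hcomp : ∀ F : 𝓢((Fin 2 → EuclideanSpace ℝ (Fin 4)), ℂ), HasCompactSupport ⇑F → tsupport ⇑F ⊆ {x | x 0 ≠ x 1} →
      Integrable (fun x => K (x 0 - x 1) * F x) ∧ S₁ 2 F = ∫ x, K (x 0 - x 1) * F x := by
    intro F hFc hF
    refine LocalKernelPatching (S₁ 2) {x | x 0 ≠ x 1} hΩ (fun x => K (x 0 - x 1)) hκ (fun z hz => ?_) F hFc hF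
    obtain ⟨r, hr, hrd, hrep⟩ := hKrep z hz
    obtain ⟨O, hO, hzO, hOrep⟩ := hR (S₁ 2) K {ξ | ξ ≠ 0} isOpen_compl_singleton hKcont z r hr
      (fun x y hx hy => sub_ne_zero.2 fun hxy => Set.disjoint_left.1 (ball_disjoint_ball hrd) hx (hxy ▸ hy)) hrep
    exact ⟨O ∩ {x | x 0 ≠ x 1}, hO.inter hΩ, ⟨hzO, hz⟩, inter_subset_right,
      fun G hG _ => (hOrep G (hG.trans inter_subset_left)).2⟩
  /- Step 8: the polynomial a-priori bound from the local bounds (`s = min (s₁/2) (‖ξ‖/4)`). -/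
  have hbd : ∃ (A : ℝ) (p : ℕ), ∀ x : EuclideanSpace ℝ (Fin 4), x ≠ 0 → ‖K x‖ ≤ A * (‖x‖ ^ p + ‖x‖⁻¹ ^ p) := by
    refine ⟨(1 + c₀) * A₀ * (1 + (2 / s₁) ^ p₀ + 4 ^ p₀), p₀, fun ξ hξ => ?_⟩
    have hn : 0 < ‖ξ‖ := norm_pos_iff.2 hξ
    set s : ℝ := min (s₁ / 2) (‖ξ‖ / 4) with hsdef
    have hs : 0 < s := lt_min (half_pos hs₁) (by positivity)
    have hs' : s < s₁ := (min_le_left _ _).trans_lt (half_lt_self hs₁)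
    have hsξ : 2 * s ≤ ‖ξ‖ / 2 := by linarith [min_le_right (s₁ / 2) (‖ξ‖ / 4)]
    obtain ⟨r₀, A, B, hr₀, hA, hB, hAB, hLB⟩ := hfam s hs hs'
    have h1 : ‖K ξ‖ ≤ A + c₀ * B := by
      rw [hK]
      exact hKm_bd s r₀ A B hs hs' hr₀ hA hB hLB ((Φ ξ).symm ξ) (by linarith [hΦ_le ξ hξ])
    have h2 : A + c₀ * B ≤ (1 + c₀) * A₀ * (1 + s⁻¹ ^ p₀) := by
      calc A + c₀ * B ≤ (1 + c₀) * (A + B) := by nlinarith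
        _ ≤ (1 + c₀) * (A₀ * (1 + s⁻¹ ^ p₀)) := mul_le_mul_of_nonneg_left hAB (by positivity)
        _ = (1 + c₀) * A₀ * (1 + s⁻¹ ^ p₀) := by ring
    have hL : 1 ≤ ‖ξ‖ ^ p₀ + ‖ξ‖⁻¹ ^ p₀ := by
      rcases le_or_gt 1 ‖ξ‖ with h1 | h1
      · linarith [one_le_pow₀ (M₀ := ℝ) h1 (n := p₀), pow_nonneg (inv_pos.2 hn).le p₀]
      · linarith [one_le_pow₀ ((one_le_inv₀ hn).2 h1.le) (n := p₀), pow_nonneg hn.le p₀]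
    have ha : (0 : ℝ) ≤ (2 / s₁) ^ p₀ := by positivity
    have hb : (0 : ℝ) ≤ 4 ^ p₀ := by positivity
    have hu : (0 : ℝ) ≤ ‖ξ‖ ^ p₀ := by positivity
    have h3 : 1 + s⁻¹ ^ p₀ ≤ (1 + (2 / s₁) ^ p₀ + 4 ^ p₀) * (‖ξ‖ ^ p₀ + ‖ξ‖⁻¹ ^ p₀) := by
      rcases le_total (s₁ / 2) (‖ξ‖ / 4) with h | h
      · have hs_eq : s⁻¹ ^ p₀ = (2 / s₁) ^ p₀ := by rw [hsdef, min_eq_left h, inv_div]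
        rw [hs_eq]
        nlinarith [mul_nonneg (by positivity : (0 : ℝ) ≤ 1 + (2 / s₁) ^ p₀ + 4 ^ p₀) (sub_nonneg.2 hL)]
      · have hs_eq : s⁻¹ ^ p₀ = 4 ^ p₀ * ‖ξ‖⁻¹ ^ p₀ := by rw [hsdef, min_eq_right h, inv_div, div_eq_mul_inv, mul_pow]
        rw [hs_eq]
        nlinarith [mul_nonneg (by positivity : (0 : ℝ) ≤ 1 + (2 / s₁) ^ p₀) (sub_nonneg.2 hL), mul_nonneg hb hu, ha]
    calc ‖K ξ‖ ≤ (1 + c₀) * A₀ * (1 + s⁻¹ ^ p₀) := h1.trans h2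
      _ ≤ (1 + c₀) * A₀ * ((1 + (2 / s₁) ^ p₀ + 4 ^ p₀) * (‖ξ‖ ^ p₀ + ‖ξ‖⁻¹ ^ p₀)) :=
          mul_le_mul_of_nonneg_left h3 (by positivity)
      _ = (1 + c₀) * A₀ * (1 + (2 / s₁) ^ p₀ + 4 ^ p₀) * (‖ξ‖ ^ p₀ + ‖ξ‖⁻¹ ^ p₀) := by ring
  /- Step 9: extension to `⁰𝒮₂`. -/
  exact ⟨K, hKcont, OffDiagonalExtension (S₁ 2) K hKcont hbd hcomp⟩

/-- **Sub-goal `KernelExistenceLet`**: the stub `KernelExistence` in `let E := ℝ⁴; let X := E²` form (the same proposition up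
to unfolding the `let`s; registered because the expanded statement of the stub exceeds the ledger's length limit for stub
signatures and was stored truncated). [folklore] -/
theorem KernelExistenceLet : open Literature.MathematicalPhysics.QuantumLattice Literature.MathematicalPhysics.AQFT Literature.MathematicalPhysics.QuantumFieldTheory in let E := EuclideanSpace ℝ (Fin 4); let X := Fin 2 → E; (∀ (S₁ : SchwingerFamily E), S₁.toLabelled.IsReflectionPositive → (∀ (n : ℕ) (a : E) (F : SchwartzMap (Fin n → E) ℂ), IsOffDiagonal F → S₁ n (translateMulti a F) = S₁ n F) → ∀ (s₁ : ℝ), 0 < s₁ → (∀ (s : ℝ), 0 < s → s < s₁ → ∃ (r₀ A B : ℝ), 0 < r₀ ∧ 0 ≤ A ∧ 0 ≤ B ∧ (∀ (r : ℝ), 0 < r → r ≤ r₀ → ∀ (f : Fin 2 → SchwartzMap E ℝ) (F : SchwartzMap X ℂ) (M₀ M₁ : ℝ), IsTensorOf F (fun i => ofRealTest (f i)) → tsupport ((f 0 : SchwartzMap E ℝ) : E → ℝ) ⊆ Metric.closedBall (EuclideanSpace.single (0 : Fin 4) (-s)) r → tsupport ((f 1 : SchwartzMap E ℝ) : E → ℝ)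 ⊆ Metric.closedBall (EuclideanSpace.single (0 : Fin 4) s) r → (∀ x, |f 0 x| ≤ M₀) → (∀ x, |f 1 x| ≤ M₁) → ‖S₁ 2 F‖ ≤ A * (∫ x : E, |f 0 x|) * (∫ x : E, |f 1 x|) + B * r ^ 8 * M₀ * M₁)) → ∃ (K : E → ℂ) (c₀ : ℝ), 0 ≤ c₀ ∧ ContinuousOn K {ξ : E | ξ 0 < 0} ∧ (∀ (s r₀ A B : ℝ), 0 < s → s < s₁ → 0 < r₀ → 0 ≤ A → 0 ≤ B → (∀ (r : ℝ), 0 < r → r ≤ r₀ → ∀ (f : Fin 2 → SchwartzMap E ℝ) (F : SchwartzMap X ℂ) (M₀ M₁ : ℝ), IsTensorOf F (fun i => ofRealTest (f i)) → tsupport ((f 0 : SchwartzMap E ℝ) : E → ℝ) ⊆ Metric.closedBall (EuclideanSpace.single (0 : Fin 4) (-s)) r → tsupport ((f 1 : SchwartzMap E ℝ) : E → ℝ) ⊆ Metric.closedBall (EuclideanSpace.single (0 : Fin 4) s) r → (∀ x, |f 0 x| ≤ M₀) → (∀ x, |f 1 x| ≤ M₁) → ‖S₁ 2 F‖ ≤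 A * (∫ x : E, |f 0 x|) * (∫ x : E, |f 1 x|) + B * r ^ 8 * M₀ * M₁) → ∀ ξ : E, ξ 0 ≤ -(2 * s) → ‖K ξ‖ ≤ A + c₀ * B) ∧ (∀ z : X, z 0 0 < 0 → 0 < z 1 0 → ∃ r : ℝ, 0 < r ∧ ∀ (f g : SchwartzMap E ℂ), tsupport (f : E → ℂ) ⊆ Metric.ball (z 0) r → tsupport (g : E → ℂ) ⊆ Metric.ball (z 1) r → ∀ F : SchwartzMap X ℂ, IsTensorOf F ![f, g] → MeasureTheory.Integrable (fun x : X => K (x 0 - x 1) * F x) ∧ S₁ 2 F = ∫ x : X, K (x 0 - x 1) * F x)) → (∀ (T : SchwartzMap X ℂ →L[ℂ] ℂ) (K : E → ℂ) (W : Set E), IsOpen W → ContinuousOn K W → ∀ (z : X) (r : ℝ), 0 < r → (∀ x y : E, x ∈ Metric.ball (z 0) r → y ∈ Metric.ball (z 1) r → x - y ∈ W) → (∀ (f g : SchwartzMap E ℂ), tsupport (f : E → ℂ) ⊆ Metric.ball (z 0) r → tsupport (g : E → ℂ) ⊆ Metric.ball (z 1) r → ∀ F : SchwartzMap X ℂ,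 IsTensorOf F ![f, g] → MeasureTheory.Integrable (fun x : X => K (x 0 - x 1) * F x) ∧ T F = ∫ x : X, K (x 0 - x 1) * F x) → ∃ O : Set X, IsOpen O ∧ z ∈ O ∧ ∀ F : SchwartzMap X ℂ, tsupport (F : X → ℂ) ⊆ O → MeasureTheory.Integrable (fun x : X => K (x 0 - x 1) * F x) ∧ T F = ∫ x : X, K (x 0 - x 1) * F x) → ∀ (S₁ : SchwingerFamily E), S₁.toLabelled.IsReflectionPositive → (∀ (n : ℕ) (a : E) (F : SchwartzMap (Fin n → E) ℂ), IsOffDiagonal F → S₁ n (translateMulti a F) = S₁ n F) → (∀ (R : E ≃ₗᵢ[ℝ] E), LinearMap.det (R.toLinearEquiv : E →ₗ[ℝ] E) = 1 → (∀ i : Fin 4, ∃ j : Fin 4, R (EuclideanSpace.single i 1) = EuclideanSpace.single j 1 ∨ R (EuclideanSpace.single i 1) = -EuclideanSpace.single j 1) → ∀ (n : ℕ) (F : SchwartzMap (Fin n → E) ℂ), IsOffDiagonal F → S₁ n (linActMulti R F) = S₁ n F) → (∃ (s₁ A₀ : ℝ) (p₀ : ℕ), 0 < s₁ ∧ 0 ≤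 A₀ ∧ (∀ (s : ℝ), 0 < s → s < s₁ → ∃ (r₀ A B : ℝ), 0 < r₀ ∧ 0 ≤ A ∧ 0 ≤ B ∧ A + B ≤ A₀ * (1 + s⁻¹ ^ p₀) ∧ (∀ (r : ℝ), 0 < r → r ≤ r₀ → ∀ (f : Fin 2 → SchwartzMap E ℝ) (F : SchwartzMap X ℂ) (M₀ M₁ : ℝ), IsTensorOf F (fun i => ofRealTest (f i)) → tsupport ((f 0 : SchwartzMap E ℝ) : E → ℝ) ⊆ Metric.closedBall (EuclideanSpace.single (0 : Fin 4) (-s)) r → tsupport ((f 1 : SchwartzMap E ℝ) : E → ℝ) ⊆ Metric.closedBall (EuclideanSpace.single (0 : Fin 4) s) r → (∀ x, |f 0 x| ≤ M₀) → (∀ x, |f 1 x| ≤ M₁) → ‖S₁ 2 F‖ ≤ A * (∫ x : E, |f 0 x|) * (∫ x : E, |f 1 x|) + B * r ^ 8 * M₀ * M₁))) → ∃ K : E → ℂ, ContinuousOn K {x : E | x ≠ 0} ∧ ∀ F : SchwartzMap X ℂ, IsOffDiagonal F → MeasureTheory.Integrable (fun x : X => K (x 0 - x 1) * F x) ∧ S₁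 2 F = ∫ x : X, K (x 0 - x 1) * F x := by
  intro E X
  exact KernelExistence

end Summit.QuantumFields.YangMills.Theorems.CurvatureKernel

end
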